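import Mathlib.Analysis.InnerProductSpace.Dual
import Mathlib.Analysis.Normed.Operator.Extend
import Mathlib.MeasureTheory.Function.L2Space
import Mathlib.Topology.Metrizable.Basic
import Literature.Analysis.FunctionSpaces.Mollification
import HarnessLib

/-!
# `L²` duality tools: Riesz representation of bounded functionals on subspaces of functions,
  essential bounds from smooth time-duality, countable dense subfamilies

Analysis/FluidPDE support file in the discharge of the class assertion of Galdi's theorem
(`Literature.Analysis.FluidPDE.galdi_lerayHopf_class`, `FluidPDE/NSGaldiEnergyEquality`; Galdi 2019,
Proc. AMS 147, Thm. 1.1: a distributional `L⁴(0,T;L⁴)` solution of Navier–Stokes with datum in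
`L²_σ` lies in `L^∞(0,T;L²) ∩ L²(0,T;H¹)`). The proof in the tree is a *duality* argument: every
piece of information about the solution `v` arrives as a bound on pairings `∫∫ ⟪v, Θ⟫` against a
class of test fields. This file supplies the three abstract devices that turn such bounds into
functions and pointwise (a.e.) statements; nothing here is specific to fluid mechanics.

## Main results (all proved)

* `Literature.Analysis.FluidPDE.exists_Lp_repr_of_forall_abs_le` — **Riesz representation from a
  bound on a subspace of functions**: if `V` is a subspace of functions `X → F` (all in `L²(μ)`,
  `F` a real Hilbert space) and `ℓ : V → ℝ` is linear with `|ℓ v| ≤ A ‖v‖_{L²}`, then there is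
  `w ∈ L²(μ; F)` with `‖w‖ ≤ A`, `∫ ⟪w, v⟫ dμ = ℓ v` on `V`, and `w` lies in every closed
  subspace of `L²` containing the classes of `V` (so `w` inherits closed linear constraints such
  as weak divergence-freeness). Proof: `L²`-classes `V → W = closure (range)`, Mathlib's
  `LinearMap.extendOfNorm` along this dense map, and `InnerProductSpace.toDual` on the complete
  subspace `W` (Brezis 2011, Thm. 5.5 (Riesz–Fréchet) with Cor. 1.8-type extension by density).
* `Literature.Analysis.FluidPDE.ae_abs_le_of_forall_abs_integral_mul_le` — **`L¹`–`L^∞` duality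
  with smooth tests**: if `h` is integrable on `(a, b)` and `|∫ η h| ≤ C ∫ |η|` for every smooth
  `η` compactly supported in `(a, b)`, then `|h| ≤ C` a.e. on `(a, b)` (mollify: test with the
  reflected translates of a bump sequence and use Lebesgue differentiation, Mathlib
  `ContDiffBump.ae_convolution_tendsto_right_of_locallyIntegrable`).
* `Literature.Analysis.FluidPDE.exists_countable_seq_dense` — in a second countable
  pseudo-metric space every indexed family has a **countable subfamily approximating each member
  along a sequence** (Mathlib `TopologicalSpace.IsSeparable.exists_countable_dense_subset`); used
  to pass "for every test field, for a.e. `t`" to "for a.e. `t`, for every test field".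

## Mathlib search

Mathlib (this pin) has the ingredients (`InnerProductSpace.toDual`, `LinearMap.extendOfNorm`,
`Submodule.topologicalClosure`, `ContDiffBump.ae_convolution_tendsto_right_of_locallyIntegrable`,
`TopologicalSpace.IsSeparable.exists_countable_dense_subset`) but no packaged statement of either
result (searched `extendOfNorm`, `toDual` + `eLpNorm`, `ae_le_of_forall.*integral` in
`MeasureTheory/`: only `ae_le_of_forall_setIntegral_le`-type lemmas with indicator tests). The
tree has the special case `V = 𝒱` (divergence-free tests) of the first result inside the proof
of `Fluid.memLp_two_of_forall_abs_integral_inner_le` (`FluidPDE/SolenoidalL2Duality`), which is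
here abstracted.

## References

* H. Brezis, *Functional Analysis, Sobolev Spaces and Partial Differential Equations*,
  Springer 2011, Thm. 5.5 (Riesz–Fréchet), Cor. 4.24 (`∫ f η = 0 ∀ η ∈ C_c^∞ ⇒ f = 0`),
  Prop. 4.21-type mollification arguments (`Brezis2011`).
* L. C. Evans, *Partial Differential Equations*, 2nd ed., AMS 2010, App. C.4, Thm. 7
  (mollifiers) (`Evans2010`).
-/

noncomputable section

open MeasureTheory TopologicalSpace Set Function Filter Topology InnerProductSpace Metric
  ContinuousLinearMap
open scoped RealInnerProductSpace ENNReal NNReal Convolution ContDiff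

namespace Literature.Analysis.FluidPDE

/-! ### Riesz representation of a functional bounded on a subspace of `L²` functions -/

section Riesz

variable {X : Type*} [MeasurableSpace X] {μ : Measure X}
variable {F : Type*} [NormedAddCommGroup F] [InnerProductSpace ℝ F] [CompleteSpace F]

/-- The range of a linear map into a normed space, co-restricted to the closure of that range,
is dense there. [folklore] -/
theorem denseRange_codRestrict_topologicalClosure {M : Type*} [NormedAddCommGroup M]
    [NormedSpace ℝ M] {V : Type*} [AddCommGroup V] [Module ℝ V] (T : V →ₗ[ℝ] M) :
    DenseRange (T.codRestrict (LinearMap.range T).topologicalClosure fun v =>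
      (LinearMap.range T).le_topologicalClosure (LinearMap.mem_range_self T v)) := by
  set W := (LinearMap.range T).topologicalClosure with hW
  rw [denseRange_iff_closure_range, eq_univ_iff_forall]
  intro z
  have hemb : IsEmbedding (Subtype.val : W → M) := IsEmbedding.subtypeVal
  rw [hemb.closure_eq_preimage_closure_image, mem_preimage]
  have himage : Subtype.val '' range (T.codRestrict W fun v =>
      (LinearMap.range T).le_topologicalClosure (LinearMap.mem_range_self T v)) =
      (LinearMap.range T : Set M) := by
    ext m
    constructor
    · rintro ⟨w, ⟨v, rfl⟩, rfl⟩
      exact ⟨v, rfl⟩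
    · rintro ⟨v, rfl⟩
      exact ⟨T.codRestrict W (fun v => (LinearMap.range T).le_topologicalClosure
        (LinearMap.mem_range_self T v)) v, ⟨v, rfl⟩, rfl⟩
  rw [himage, ← Submodule.topologicalClosure_coe]
  exact z.2

/-- **Riesz representation from a bound on a subspace of functions.** Let `V` be a subspace of
functions `X → F` all of whose members are in `L²(μ; F)` (`F` a real Hilbert space), and let
`ℓ : V → ℝ` be linear with `|ℓ v| ≤ A ‖v‖_{L²(μ)}` for some `A ≥ 0`. Then there is a class
`w ∈ L²(μ; F)` with `‖w‖ ≤ A` representing `ℓ`, `∫ ⟪w, v⟫ dμ = ℓ v` for all `v ∈ V`, which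
moreover belongs to every closed subspace of `L²(μ; F)` containing the classes of the members of
`V` (Riesz–Fréchet, Brezis 2011, Thm. 5.5, applied on the closure `W` of the classes of `V`
after extending `ℓ` to `W` by density, Mathlib `LinearMap.extendOfNorm`). [cite: Brezis2011, Thm. 5.5] -/
theorem exists_Lp_repr_of_forall_abs_le (V : Submodule ℝ (X → F)) (hV : ∀ v ∈ V, MemLp v 2 μ)
    (ℓ : V →ₗ[ℝ] ℝ) {A : ℝ} (hA : 0 ≤ A)
    (hℓ : ∀ v : V, |ℓ v| ≤ A * (eLpNorm (v : X → F) 2 μ).toReal) :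
    ∃ w : Lp F 2 μ, ‖w‖ ≤ A ∧
      (∀ v : V, ∫ x, ⟪(w : X → F) x, (v : X → F) x⟫ ∂μ = ℓ v) ∧
      ∀ S : Submodule ℝ (Lp F 2 μ), IsClosed (S : Set (Lp F 2 μ)) →
        (∀ v : V, (hV v v.2).toLp (v : X → F) ∈ S) → w ∈ S := by
  -- the class map `T : V → L²`
  set T : V →ₗ[ℝ] Lp F 2 μ :=
    { toFun := fun v => (hV v v.2).toLp (v : X → F)
      map_add' := fun v v' => by
        have h := MemLp.toLp_add (hV v v.2) (hV v' v'.2)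
        exact h.symm ▸ rfl
      map_smul' := fun c v => by
        have h := MemLp.toLp_const_smul c (hV v v.2)
        exact h.symm ▸ rfl } with hT_def
  have hTco : ∀ v : V, ((T v : Lp F 2 μ) : X → F) =ᵐ[μ] (v : X → F) := fun v =>
    MemLp.coeFn_toLp (hV v v.2)
  have hTnorm : ∀ v : V, ‖T v‖ = (eLpNorm (v : X → F) 2 μ).toReal := fun v => by
    rw [Lp.norm_def]
    exact congrArg ENNReal.toReal (eLpNorm_congr_ae (hTco v))
  -- the closure `W` of its range, a complete inner product space, and the dense map `e : V → W`
  set W : Submodule ℝ (Lp F 2 μ) := (LinearMap.range T).topologicalClosure with hW_def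
  haveI : CompleteSpace W := Submodule.topologicalClosure.completeSpace _
  set e : V →ₗ[ℝ] W := T.codRestrict W fun v =>
    (LinearMap.range T).le_topologicalClosure (LinearMap.mem_range_self T v) with he_def
  have hdense : DenseRange e := denseRange_codRestrict_topologicalClosure T
  have he_coe : ∀ v : V, (e v : Lp F 2 μ) = T v := fun v => rfl
  have hle : ∀ v : V, ‖ℓ v‖ ≤ A * ‖e v‖ := fun v => by
    rw [Real.norm_eq_abs, Submodule.coe_norm, he_coe, hTnorm]
    exact hℓ v
  -- extension to `W` and Riesz representation
  set L : W →L[ℝ] ℝ := ℓ.extendOfNorm e with hL_def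
  have hL_eq : ∀ v : V, L (e v) = ℓ v := fun v => LinearMap.extendOfNorm_eq hdense ⟨A, hle⟩ v
  have hL_norm : ‖L‖ ≤ A := LinearMap.opNorm_extendOfNorm_le hdense hA hle
  set h : W := (InnerProductSpace.toDual ℝ W).symm L with hh_def
  have hh_inner : ∀ y : W, ⟪h, y⟫ = L y := fun y => InnerProductSpace.toDual_symm_apply
  have hh_norm : ‖h‖ ≤ A := by
    rw [hh_def, LinearIsometryEquiv.norm_map]
    exact hL_norm
  refine ⟨(h : Lp F 2 μ), by simpa [Submodule.coe_norm] using hh_norm, fun v => ?_, fun S hS hSV => ?_⟩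
  · rw [← hL_eq v, ← hh_inner (e v), Submodule.coe_inner, he_coe, L2.inner_def]
    refine integral_congr_ae ?_
    filter_upwards [hTco v] with x hx
    rw [hx]
  · have hrange : LinearMap.range T ≤ S := by
      rintro _ ⟨v, rfl⟩
      exact hSV v
    exact (LinearMap.range T).topologicalClosure_minimal hrange hS h.2

end Riesz

/-! ### Essential bounds from duality with smooth compactly supported functions of time -/

section TimeDuality

/-- **`|h| ≤ C` a.e. from `|∫ η h| ≤ C ‖η‖₁` for smooth `η`.** Let `h` be integrable on `(a, b)`
and suppose `|∫_{(a,b)} η h| ≤ C ∫ |η|` for every smooth `η : ℝ → ℝ` with compact support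
contained in `(a, b)`. Then `|h t| ≤ C` for a.e. `t ∈ (a, b)`. Proof: at a Lebesgue point `t` of
(the extension by zero of) `h`, test with the reflected translates `η_n = ρ_n(t - ·)` of a
mollifier sequence (unit mass, eventually supported in `(a, b)`): `∫ η_n h = (ρ_n ⋆ h)(t) → h(t)`
(Evans 2010, App. C.4, Thm. 7 (ii); Brezis 2011, Cor. 4.24 for the equality case). [folklore] -/
theorem ae_abs_le_of_forall_abs_integral_mul_le {a b C : ℝ} {h : ℝ → ℝ}
    (hh : IntegrableOn h (Ioo a b))
    (hbd : ∀ η : ℝ → ℝ, ContDiff ℝ ∞ η → HasCompactSupport η → tsupport η ⊆ Ioo a b →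
      |∫ t in Ioo a b, η t * h t| ≤ C * ∫ t, |η t|) :
    ∀ᵐ t ∂(volume.restrict (Ioo a b)), |h t| ≤ C := by
  set g : ℝ → ℝ := (Ioo a b).indicator h with hg_def
  have hgi : Integrable g volume := hh.integrable_indicator measurableSet_Ioo
  have hgl : LocallyIntegrable g volume := hgi.locallyIntegrable
  obtain ⟨ρ, hρ0, hρ2⟩ := FunctionSpaces.exists_contDiffBump_seq (E := ℝ)
  have hlim := FunctionSpaces.ae_tendsto_normed_convolution hρ0 hρ2 hgl
  rw [ae_restrict_iff' measurableSet_Ioo]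
  filter_upwards [hlim] with t ht htI
  -- eventually the translated bump is supported in `(a, b)`
  have hev : ∀ᶠ n in atTop, closedBall t (ρ n).rOut ⊆ Ioo a b := by
    obtain ⟨ε, hε, hεI⟩ := Metric.isOpen_iff.1 isOpen_Ioo t htI
    filter_upwards [(tendsto_order.1 hρ0).2 ε hε] with n hn
    exact (closedBall_subset_ball hn).trans hεI
  -- along the sequence, `(ρ_n ⋆ g)(t) = ∫_{(a,b)} η_n h` with `η_n = ρ_n(t - ·)` admissible
  have hval : ∀ᶠ n in atTop, |((ρ n).normed volume ⋆[lsmul ℝ ℝ, volume] g) t| ≤ C := by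
    filter_upwards [hev] with n hn
    set η : ℝ → ℝ := fun s => (ρ n).normed volume (t - s) with hη_def
    have hηs : ContDiff ℝ ∞ η := (ρ n).contDiff_normed.comp (contDiff_const.sub contDiff_id)
    have hηc : HasCompactSupport η :=
      (ρ n).hasCompactSupport_normed.comp_homeomorph (Homeomorph.subLeft t)
    have hηsupp : tsupport η ⊆ Ioo a b := by
      refine (closure_minimal (fun s hs => ?_) isClosed_closedBall).trans hn
      have hs' : t - s ∈ Function.support ((ρ n).normed volume) := hs
      rw [(ρ n).support_normed_eq, mem_ball, dist_zero_right, Real.norm_eq_abs] at hs'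
      rw [mem_closedBall, dist_comm, Real.dist_eq]
      exact hs'.le
    have hηint : ∫ s, |η s| = 1 := by
      have h1 : (fun s => |η s|) = fun s => (fun r => (ρ n).normed volume r) (t - s) := by
        funext s
        exact abs_of_nonneg ((ρ n).nonneg_normed _)
      rw [h1, integral_sub_left_eq_self (fun r => (ρ n).normed volume r) volume t]
      exact (ρ n).integral_normed
    have hconv : ((ρ n).normed volume ⋆[lsmul ℝ ℝ, volume] g) t = ∫ s in Ioo a b, η s * h s := by
      rw [convolution_def]
      simp only [lsmul_apply, smul_eq_mul]
      have e := integral_sub_left_eq_self (fun r => (ρ n).normed volume r * g (t - r)) volume t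
      simp only [sub_sub_cancel] at e
      rw [← e, ← integral_indicator measurableSet_Ioo]
      refine integral_congr_ae (Eventually.of_forall fun s => ?_)
      simp only [hg_def, hη_def]
      by_cases hs : s ∈ Ioo a b
      · simp [indicator_of_mem hs]
      · simp [indicator_of_notMem hs]
    have h := hbd η hηs hηc hηsupp
    rw [hηint, mul_one, ← hconv] at h
    exact h
  have hlim_abs : Tendsto (fun n => |((ρ n).normed volume ⋆[lsmul ℝ ℝ, volume] g) t|) atTop
      (𝓝 |g t|) := (continuous_abs.tendsto _).comp ht
  have hle : |g t| ≤ C := le_of_tendsto hlim_abs hval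
  simpa [hg_def, indicator_of_mem htI] using hle

end TimeDuality

/-! ### Countable approximating subfamilies -/

section Countable

/-- **Countable approximating subfamilies.** For any family `J : ι → M` in a second countable
pseudo-metric space and any index set `S`, there is a countable `D ⊆ S` such that every `J i`,
`i ∈ S`, is the limit of a sequence `J (u n)` with `u n ∈ D` (the range is separable; Mathlib
`TopologicalSpace.IsSeparable.exists_countable_dense_subset`). Typical use: `M` a product of `L^p`
spaces, to swap "for every test field, for a.e. `t`" into "for a.e. `t`, for every test field". [folklore] -/
theorem exists_countable_seq_dense {ι M : Type*} [PseudoMetricSpace M] [SecondCountableTopology M]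
    (J : ι → M) (S : Set ι) :
    ∃ D ⊆ S, D.Countable ∧ ∀ i ∈ S, ∃ u : ℕ → ι, (∀ n, u n ∈ D) ∧
      Tendsto (fun n => J (u n)) atTop (𝓝 (J i)) := by
  rcases S.eq_empty_or_nonempty with rfl | ⟨i₀, hi₀⟩
  · exact ⟨∅, Subset.rfl, countable_empty, fun i hi => hi.elim⟩
  have hsep : IsSeparable (J '' S) := IsSeparable.of_separableSpace _
  obtain ⟨t, htS, htc, hdense⟩ := hsep.exists_countable_dense_subset
  -- choose preimages in `S` of the points of `t`
  have hpre : ∀ y : t, ∃ i ∈ S, J i = (y : M) := fun y => htS y.2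
  choose π hπS hπJ using hpre
  haveI : Countable t := htc.to_subtype
  refine ⟨Set.range π, ?_, countable_range π, fun i hi => ?_⟩
  · rintro _ ⟨y, rfl⟩
    exact hπS y
  have hmem : J i ∈ closure t := hdense ⟨i, hi, rfl⟩
  obtain ⟨y, hyt, hylim⟩ := mem_closure_iff_seq_limit.1 hmem
  refine ⟨fun n => π ⟨y n, hyt n⟩, fun n => ⟨⟨y n, hyt n⟩, rfl⟩, ?_⟩
  have heq : (fun n => J (π ⟨y n, hyt n⟩)) = y := funext fun n => hπJ ⟨y n, hyt n⟩
  rw [heq]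
  exact hylim

end Countable

end Literature.Analysis.FluidPDE
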